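import Summits.QuantumAdvantage.QuantumAdvantage.Theorems.WbwObfuscatedGluedTreesKowPhPrograms
import Summits.QuantumAdvantage.QuantumAdvantage.Theorems.WbwObfuscatedGluedTreesKowNbrPrp

/-!
# `WbwObfuscatedGluedTrees` (stmt-QuantumAdvantage-2340) — line `knowledge-of-walk-split`, STAGE 7 (the PRF hybrid):
# the layer-B program is polynomial time on codes (registered stub `stub_primFP`)

The two maps of the adaptive straight-line program of layer B (`KowPhPrograms` §4) — the next table lookup
`primQ μ d body as` and the final answer `primOut μ d body as` — are computed on the codes
`⟨⟨⟨1^μ, 1^d⟩, body⟩, as⟩` (`pairE (pairE (pairE unE unE) strE) (listE strE)`) by polynomial-time string functions,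
in the tree's `CodeFP` algebra:

* §1 semantics helpers: the Feistel state `prpFold` is a left fold over the answers of the step
  `(W, s) ↦ (W ⊕ (M_s ∧ fit d (fit μ a)), s + 1)` whose state never grows (`|W'| ≤ |W|`), and the `match` of
  `primQ` / `primOut` on the request body is a cascade of tests on its first three bits and its length;
* §2 bricks: `fit`, `⊕`, masked `zipWith`, the masks `maskLow` / `maskHigh` and the round schedule `prpRound`
  (stage-3 bricks `prpKit_*` of toolkit `NbrBitFP`), `bitsOf 8 r` (as `fit 8` of the binary numeral), the label test
  `isLabelB` (the exponent capped by the unary `d`: no exponential), and the three request kinds (ENCRYPT, RECOGNISE,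
  PERMUTATION) as typed combinators over computed arguments;
* §3 the fold on codes (`CodeFP.foldl` with the linear growth bound) and the assembly by `CodeFP.ite`.

[folklore] (closure of polynomial time under composition and polynomially bounded loops, AroraBarak2009 §1.3;
objects: LubyRackoff1988 (Feistel rounds), Goldreich2004FoC2 Constructions 5.3.9 / 5.4.19 (SIV naming)).
-/

set_option linter.dupNamespace false

noncomputable section

namespace Summit.QuantumAdvantage.QuantumAdvantage.Theorems.WbwObfuscatedGluedTrees.KnowledgeOfWalk.PrfHybrid

open Literature.Computability.Complexity Literature.Computability.QuantumComplexity
open Literature.Computability.QuantumComplexity.GluedTrees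
open Literature.Computability.Cryptography Literature.Computability.Cryptography.ObfuscatedGluedTrees
open Summit.QuantumAdvantage.QuantumAdvantage.Theorems.WbwObfuscatedGluedTrees.KnowledgeOfWalk.BlackBox
open Summit.QuantumAdvantage.QuantumAdvantage.Theorems.WbwObfuscatedGluedTrees.KnowledgeOfWalk.RealIdeal
open Summit.QuantumAdvantage.QuantumAdvantage.Theorems.WbwObfuscatedGluedTrees.KnowledgeOfWalk.Generator
open _root_.Computability
open Literature.Computability.Complexity.CodeFP (unE pairE strE listE natE bitE rawE fst snd const strTake strDrop
  strAppend strLength strVal strOfNat natOfUn unSucc unAdd unMulConst unOfNatMin natPow natLt natLeUn natEq natMod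
  ulength rawOfList rawGetD strGetD consBit unE_injective pairE_apply length_unE length_le_length_rawE)

/-! ## §1 Semantics helpers: the Feistel fold, the dispatch on the request body -/

/-- The Feistel state `prpFold` as a left fold over the answers of the step
`(W, s) ↦ (W ⊕ (M_s ∧ fit d (fit μ a)), s + 1)` (the counter ends at `s + |as|`).
[cite: LubyRackoff1988, main construction] -/
private theorem pf_foldl_eq (μ d : ℕ) (inv : Bool) :
    ∀ (l : List (List Bool)) (W : List Bool) (s : ℕ),
      l.foldl (fun (st : List Bool × ℕ) (a : List Bool) =>
          (ObfuscatedGluedTrees.bxor st.1 (List.zipWith (fun m b => m && b) (prpRound d inv st.2).2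
            (fit d (fit μ a))), st.2 + 1)) (W, s) =
        (prpFold μ d inv W s l, s + l.length)
  | [], _, _ => rfl
  | a :: l, W, s => by
    rw [List.foldl_cons, pf_foldl_eq μ d inv l]
    refine Prod.ext rfl ?_
    simp only [List.length_cons]
    omega

/-- The Feistel state never grows: `|prpFold μ d inv W s as| ≤ |W|` (each step is a truncating `⊕`). [folklore] -/
private theorem pf_length_prpFold_le (μ d : ℕ) (inv : Bool) :
    ∀ (l : List (List Bool)) (W : List Bool) (s : ℕ), (prpFold μ d inv W s l).length ≤ W.length
  | [], _, _ => le_rfl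
  | a :: l, W, s => by
    rw [prpFold]
    exact (pf_length_prpFold_le μ d inv l _ _).trans
      (by rw [ObfuscatedGluedTrees.length_bxor]; exact min_le_left _ _)

/-- **The query map by tests**: the `match` of `primQ` on the body is the cascade "at least two bits? first bit?
at least three bits? second bit?" over the PERMUTATION / RECOGNISE / ENCRYPT branches read at `body.getD`,
`body.drop`. [folklore] -/
private theorem pf_primQ_eq (μ d : ℕ) (body : List Bool) (as : List (List Bool)) :
    primQ μ d body as =
      if decide (2 ≤ body.length) then
        if body.getD 0 false then
          if decide (3 ≤ body.length) then
            prpLookup μ d (body.getD 1 false) (if body.getD 2 false then 3 else 2) as.length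
              (prpFold μ d (body.getD 1 false) (fit d (body.drop 3)) 0 as)
          else dummyLookup μ
        else if body.getD 1 false then
          (if as.length = 0 then tkey 1 ++ fit μ ((body.drop 2).take μ)
          else if as.length = 1 then
            tkey 0 ++ fit μ (ObfuscatedGluedTrees.bxor ((body.drop 2).drop μ)
              (fit ((body.drop 2).length - μ) (fit μ (as.getD 0 []))))
          else dummyLookup μ)
        else
          (if as.length = 0 then tkey 0 ++ fit μ (body.drop 2)
          else if as.length = 1 then tkey 1 ++ fit μ (as.getD 0 []) else dummyLookup μ)
      else dummyLookup μ := by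
  rcases body with _ | ⟨b₀, _ | ⟨b₁, rest⟩⟩
  · rfl
  · cases b₀ <;> rfl
  · cases b₀
    · cases b₁ <;> simp [primQ]
    · rcases rest with _ | ⟨tb, w⟩
      · cases b₁ <;> rfl
      · simp [primQ]

/-- **The output map by tests** (same cascade as `pf_primQ_eq`). [folklore] -/
private theorem pf_primOut_eq (μ d : ℕ) (body : List Bool) (as : List (List Bool)) :
    primOut μ d body as =
      if decide (2 ≤ body.length) then
        if body.getD 0 false then
          if decide (3 ≤ body.length) then prpFold μ d (body.getD 1 false) (fit d (body.drop 3)) 0 as else []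
        else if body.getD 1 false then
          (if (body.drop 2).length = μ + labelLen d ∧ fit μ (as.getD 1 []) = (body.drop 2).take μ ∧
              isLabelB d (ObfuscatedGluedTrees.bxor ((body.drop 2).drop μ)
                (fit ((body.drop 2).length - μ) (fit μ (as.getD 0 [])))) = true then
            true :: ObfuscatedGluedTrees.bxor ((body.drop 2).drop μ)
              (fit ((body.drop 2).length - μ) (fit μ (as.getD 0 [])))
          else [])
        else fit μ (as.getD 0 []) ++
          ObfuscatedGluedTrees.bxor (body.drop 2) (fit (body.drop 2).length (fit μ (as.getD 1 [])))
      else [] := by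
  rcases body with _ | ⟨b₀, _ | ⟨b₁, rest⟩⟩
  · rfl
  · cases b₀ <;> rfl
  · cases b₀
    · cases b₁ <;> simp [primOut]
    · rcases rest with _ | ⟨tb, w⟩
      · cases b₁ <;> rfl
      · simp [primOut]

/-! ## §2 Bricks: typed combinators over computed arguments -/

section Bricks

variable {α : Type} {eα : α → List Bool}

/-- `fit` of computed arguments. [folklore] -/
private theorem pf_fit {f : α → ℕ} {g : α → List Bool} (hf : CodeFP eα unE f) (hg : CodeFP eα strE g) :
    CodeFP eα strE (fun a => fit (f a) (g a)) :=
  FPData.fitFP.comp (hf.pair hg)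

/-- Bitwise `⊕` of computed strings. [folklore] -/
private theorem pf_bxor {f g : α → List Bool} (hf : CodeFP eα strE f) (hg : CodeFP eα strE g) :
    CodeFP eα strE (fun a => ObfuscatedGluedTrees.bxor (f a) (g a)) :=
  ((prpKit_strZipWith fun a b => xor a b).comp (hf.pair hg)).congr fun _ => rfl

/-- `zipWith` of a Boolean connective of computed strings. [folklore] -/
private theorem pf_zip (c : Bool → Bool → Bool) {f g : α → List Bool} (hf : CodeFP eα strE f)
    (hg : CodeFP eα strE g) : CodeFP eα strE (fun a => List.zipWith c (f a) (g a)) :=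
  (prpKit_strZipWith c).comp (hf.pair hg)

/-- A lookup `tkey i ++ fit μ x` of computed `μ`, `x`. [folklore] -/
private theorem pf_keyFit (i : Fin 4) {f : α → ℕ} {g : α → List Bool} (hf : CodeFP eα unE f)
    (hg : CodeFP eα strE g) : CodeFP eα strE (fun a => tkey i ++ fit (f a) (g a)) :=
  strAppend.comp ((const eα (tkey i)).pair (pf_fit hf hg))

/-- The dummy lookup of a computed `μ`. [folklore] -/
private theorem pf_dummy {f : α → ℕ} (hf : CodeFP eα unE f) : CodeFP eα strE (fun a => dummyLookup (f a)) :=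
  (strAppend.comp ((const eα (tkey 0)).pair (FPData.zeros.comp hf))).congr fun _ => rfl

/-- `decide (s = n)` for a computed unary `s` and a constant `n`. [folklore] -/
private theorem pf_isLen {f : α → ℕ} (hf : CodeFP eα unE f) (n : ℕ) :
    CodeFP eα bitE (fun a => decide (f a = n)) :=
  (CodeFP.eq unE_injective).comp (hf.pair (const eα n))

/-- `1^d ↦ 1^{labelLen d}` (`labelLen d = 2d + 3`). [folklore] -/
private theorem pf_labelLen {f : α → ℕ} (hf : CodeFP eα unE f) : CodeFP eα unE (fun a => labelLen (f a)) :=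
  (unSucc.comp (unSucc.comp (unSucc.comp ((unMulConst 2).comp hf)))).congr fun _ => rfl

/-- The binary numeral of `m`, fitted to `w` bits, is `bitsOf w m` (adapted from toolkit `NbrBitFP`, piece G3).
[folklore] -/
private theorem pf_fit_natE (w m : ℕ) : fit w (natE m) = bitsOf w m := by
  refine List.ext_getElem (by simp) fun t h₁ h₂ => ?_
  rw [length_bitsOf] at h₂
  have hb : (bitsOf w m)[t]'(by simpa using h₂) = m.testBit t := by simp [bitsOf]
  rw [hb]
  simp only [fit, List.getElem_take, List.getElem_append]
  split_ifs with h
  · have := Com.testBit_bitsToNat (natE m) t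
    rw [CodeFP.bitsToNat_natE, List.getD_eq_getElem _ _ h] at this
    exact this.symm
  · rw [List.getElem_replicate]
    exact (Nat.testBit_lt_two_pow (Nat.size_le.1 (by rw [← CodeFP.length_natE]; omega))).symm

/-- `bitsOf 8 r` of a computed unary `r` (`fit 8` of its binary numeral). [folklore] -/
private theorem pf_bitsOf8 {f : α → ℕ} (hf : CodeFP eα unE f) : CodeFP eα strE (fun a => bitsOf 8 (f a)) :=
  (pf_fit (const eα 8) (strOfNat.comp (natOfUn.comp hf))).congr fun a => pf_fit_natE 8 (f a)

/-- The mask of a Feistel step (`maskLow` / `maskHigh` by the parity of the step and the direction), of computed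
`d`, `inv`, `s`. [cite: LubyRackoff1988, main construction] -/
private theorem pf_mask {fd fs : α → ℕ} {fi : α → Bool} (hd : CodeFP eα unE fd) (hi : CodeFP eα bitE fi)
    (hs : CodeFP eα unE fs) : CodeFP eα strE (fun a => (prpRound (fd a) (fi a) (fs a)).2) := by
  have he : CodeFP eα bitE (fun a => decide (fs a % 2 = 0)) :=
    natEq.comp ((natMod.comp ((natOfUn.comp hs).pair (const eα 2))).pair (const eα 0))
  have hL : CodeFP eα strE (fun a => maskLow (fd a)) :=
    (prpKit_lowMaskFP.comp hd).congr fun a => prpKit_ofFn_lowHalf (fd a)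
  have hH : CodeFP eα strE (fun a => maskHigh (fd a)) :=
    (prpKit_highMaskFP.comp hd).congr fun a => prpKit_ofFn_highHalf (fd a)
  refine ((hi.ite (he.ite hH hL) (he.ite hL hH))).congr fun a => ?_
  unfold prpRound
  cases fi a <;> simp

/-- The round index of a Feistel step (`s` forward, `3 - s` backward), in unary.
[cite: LubyRackoff1988, main construction] -/
private theorem pf_ridx {fd fs : α → ℕ} {fi : α → Bool} (hi : CodeFP eα bitE fi) (hs : CodeFP eα unE fs) :
    CodeFP eα unE (fun a => (prpRound (fd a) (fi a) (fs a)).1) := by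
  refine ((hi.ite (MachineA.unSub.comp ((const eα 3).pair hs)) hs)).congr fun a => ?_
  unfold prpRound
  cases fi a <;> simp

/-- The label test `isLabelB` of computed `d`, `x` (the exponent of the position bound capped by the unary `d`, which
does not change the conjunction). [folklore] -/
private theorem pf_isLabelB {fd : α → ℕ} {fx : α → List Bool} (hd : CodeFP eα unE fd) (hx : CodeFP eα strE fx) :
    CodeFP eα bitE (fun a => isLabelB (fd a) (fx a)) := by
  have hj : CodeFP eα natE (fun a => bitsToNat (((fx a).drop 1).take (fd a + 1))) :=
    strVal.comp (strTake.comp ((unSucc.comp hd).pair (strDrop.comp ((const eα 1).pair hx))))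
  have hi : CodeFP eα natE (fun a => bitsToNat (((fx a).drop (fd a + 2)).take (fd a + 1))) :=
    strVal.comp (strTake.comp ((unSucc.comp hd).pair (strDrop.comp ((unSucc.comp (unSucc.comp hd)).pair hx))))
  have hl : CodeFP eα bitE (fun a => decide ((fx a).length = labelLen (fd a))) :=
    (CodeFP.eq unE_injective).comp ((strLength.comp hx).pair (pf_labelLen hd))
  have hp : CodeFP eα natE (fun a => 2 ^ min (bitsToNat (((fx a).drop 1).take (fd a + 1))) (fd a)) :=
    natPow.comp ((const eα 2).pair (unOfNatMin.comp (hd.pair hj)))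
  refine ((hl.and (natLeUn.comp (hj.pair hd))).and (natLt.comp (hi.pair hp))).congr fun a => ?_
  unfold isLabelB
  by_cases h : bitsToNat (((fx a).drop 1).take (fd a + 1)) ≤ fd a
  · rw [min_eq_left h]
  · rw [decide_eq_false h]
    simp only [Bool.and_false, Bool.false_and]

/-- ENCRYPT, the lookups: the tag of the fitted label, then the mask of the tag.
[cite: Goldreich2004FoC2, Construction 5.4.19] -/
private theorem pf_encQ {fμ fs : α → ℕ} {fℓ fa : α → List Bool} (hμ : CodeFP eα unE fμ)
    (hℓ : CodeFP eα strE fℓ) (hs : CodeFP eα unE fs) (ha : CodeFP eα strE fa) :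
    CodeFP eα strE (fun a => if fs a = 0 then tkey 0 ++ fit (fμ a) (fℓ a)
      else if fs a = 1 then tkey 1 ++ fit (fμ a) (fa a) else dummyLookup (fμ a)) :=
  ((pf_isLen hs 0).ite (pf_keyFit 0 hμ hℓ) ((pf_isLen hs 1).ite (pf_keyFit 1 hμ ha) (pf_dummy hμ))).congr
    fun a => by simp only [decide_eq_true_eq]

/-- ENCRYPT, the output `tag ++ (ℓ ⊕ mask)`. [cite: Goldreich2004FoC2, Construction 5.4.19] -/
private theorem pf_encOut {fμ : α → ℕ} {fℓ fa fb : α → List Bool} (hμ : CodeFP eα unE fμ)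
    (hℓ : CodeFP eα strE fℓ) (ha : CodeFP eα strE fa) (hb : CodeFP eα strE fb) :
    CodeFP eα strE (fun a => fit (fμ a) (fa a) ++
      ObfuscatedGluedTrees.bxor (fℓ a) (fit (fℓ a).length (fit (fμ a) (fb a)))) :=
  strAppend.comp ((pf_fit hμ ha).pair (pf_bxor hℓ (pf_fit (strLength.comp hℓ) (pf_fit hμ hb))))

/-- RECOGNISE, the candidate label `(y ⇂ μ) ⊕ fit (|y| - μ) (fit μ a₀)`.
[cite: Goldreich2004FoC2, Construction 5.4.19] -/
private theorem pf_recX {fμ : α → ℕ} {fy fa : α → List Bool} (hμ : CodeFP eα unE fμ) (hy : CodeFP eα strE fy)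
    (ha : CodeFP eα strE fa) :
    CodeFP eα strE (fun a => ObfuscatedGluedTrees.bxor ((fy a).drop (fμ a))
      (fit ((fy a).length - fμ a) (fit (fμ a) (fa a)))) :=
  pf_bxor (strDrop.comp (hμ.pair hy)) (pf_fit (MachineA.unSub.comp ((strLength.comp hy).pair hμ)) (pf_fit hμ ha))

/-- RECOGNISE, the lookups: the mask of the tag part, then the tag of the candidate label.
[cite: Goldreich2004FoC2, Construction 5.4.19] -/
private theorem pf_recQ {fμ fs : α → ℕ} {fy fa : α → List Bool} (hμ : CodeFP eα unE fμ)
    (hy : CodeFP eα strE fy) (hs : CodeFP eα unE fs) (ha : CodeFP eα strE fa) :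
    CodeFP eα strE (fun a => if fs a = 0 then tkey 1 ++ fit (fμ a) ((fy a).take (fμ a))
      else if fs a = 1 then tkey 0 ++ fit (fμ a) (ObfuscatedGluedTrees.bxor ((fy a).drop (fμ a))
        (fit ((fy a).length - fμ a) (fit (fμ a) (fa a))))
      else dummyLookup (fμ a)) :=
  ((pf_isLen hs 0).ite (pf_keyFit 1 hμ (strTake.comp (hμ.pair hy))) ((pf_isLen hs 1).ite
    (strAppend.comp ((const eα (tkey 0)).pair (pf_fit hμ (pf_recX hμ hy ha)))) (pf_dummy hμ))).congr
    fun a => by simp only [decide_eq_true_eq]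

/-- RECOGNISE, the output: `1·x` for the candidate label `x` if `y` has the length of a name, its tag recomputes and
`x` is a label, `[]` otherwise. [cite: Goldreich2004FoC2, Construction 5.4.19] -/
private theorem pf_recOut {fμ fd : α → ℕ} {fy fa fb : α → List Bool} (hμ : CodeFP eα unE fμ)
    (hd : CodeFP eα unE fd) (hy : CodeFP eα strE fy) (ha : CodeFP eα strE fa) (hb : CodeFP eα strE fb) :
    CodeFP eα strE (fun a =>
      if (fy a).length = fμ a + labelLen (fd a) ∧ fit (fμ a) (fb a) = (fy a).take (fμ a) ∧
          isLabelB (fd a) (ObfuscatedGluedTrees.bxor ((fy a).drop (fμ a))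
            (fit ((fy a).length - fμ a) (fit (fμ a) (fa a)))) = true then
        true :: ObfuscatedGluedTrees.bxor ((fy a).drop (fμ a)) (fit ((fy a).length - fμ a) (fit (fμ a) (fa a)))
      else []) := by
  have hX := pf_recX hμ hy ha
  have h1 : CodeFP eα bitE (fun a => decide ((fy a).length = fμ a + labelLen (fd a))) :=
    (CodeFP.eq unE_injective).comp ((strLength.comp hy).pair (unAdd.comp (hμ.pair (pf_labelLen hd))))
  have h2 : CodeFP eα bitE (fun a => decide (fit (fμ a) (fb a) = (fy a).take (fμ a))) :=
    (CodeFP.eq (eα := strE) fun _ _ h => h).comp ((pf_fit hμ hb).pair (strTake.comp (hμ.pair hy)))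
  refine ((h1.and (h2.and (pf_isLabelB hd hX))).ite (consBit.comp ((const eα true).pair hX))
    (const eα ([] : List Bool))).congr fun a => ?_
  simp only [Bool.and_eq_true, decide_eq_true_eq]

/-- PERMUTATION, the lookup of a Feistel step at the current state `W`:
`tkey (2 + tb) ++ fit μ (⟨r⟩₈ ++ (¬M ∧ W))`. [cite: LubyRackoff1988, main construction] -/
private theorem pf_prpQ {fμ fd fs : α → ℕ} {fi ft : α → Bool} {fW : α → List Bool} (hμ : CodeFP eα unE fμ)
    (hd : CodeFP eα unE fd) (hi : CodeFP eα bitE fi) (ht : CodeFP eα bitE ft) (hs : CodeFP eα unE fs)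
    (hW : CodeFP eα strE fW) :
    CodeFP eα strE (fun a => prpLookup (fμ a) (fd a) (fi a) (if ft a then 3 else 2) (fs a) (fW a)) := by
  have hk : CodeFP eα strE (fun a => if ft a then tkey 3 else tkey 2) :=
    ht.ite (const eα (tkey 3)) (const eα (tkey 2))
  have hin : CodeFP eα strE (fun a => bitsOf 8 (prpRound (fd a) (fi a) (fs a)).1 ++
      List.zipWith (fun m b => !m && b) (prpRound (fd a) (fi a) (fs a)).2 (fW a)) :=
    strAppend.comp ((pf_bitsOf8 (pf_ridx (fd := fd) hi hs)).pair
      (pf_zip (fun m b => !m && b) (pf_mask hd hi hs) hW))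
  refine (strAppend.comp (hk.pair (pf_fit hμ hin))).congr fun a => ?_
  unfold prpLookup
  cases ft a <;> rfl

end Bricks

/-! ## §3 The fold on codes and the assembly -/

/-- **The Feistel state on codes**: `⟨⟨⟨1^μ, 1^d⟩, body⟩, as⟩ ↦ prpFold μ d inv (fit d w) 0 as` (`inv = body[1]`,
`w = body ⇂ 3`), by the tree's `CodeFP.foldl` — the state code `⟨W, 1^s⟩` has `|W| ≤ d` and `s ≤ |as|`, linear in
the input. [cite: AroraBarak2009, §1.3 (polynomially bounded loops)] -/
private theorem pf_foldFP :
    CodeFP (pairE (pairE (pairE unE unE) strE) (rawE strE)) strE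
      (fun q : ((ℕ × ℕ) × List Bool) × List (List Bool) =>
        prpFold q.1.1.1 q.1.1.2 (q.1.2.getD 1 false) (fit q.1.1.2 (q.1.2.drop 3)) 0 q.2) := by
  have tμ : CodeFP (pairE (pairE (pairE unE unE) strE) (pairE strE (pairE strE unE))) unE (fun t => t.1.1.1) :=
    (fst _ _).fst'.fst'
  have td : CodeFP (pairE (pairE (pairE unE unE) strE) (pairE strE (pairE strE unE))) unE (fun t => t.1.1.2) :=
    (fst _ _).fst'.snd'
  have ti : CodeFP (pairE (pairE (pairE unE unE) strE) (pairE strE (pairE strE unE))) bitE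
      (fun t => t.1.2.getD 1 false) :=
    strGetD.comp ((const _ 1).pair (fst _ _).snd')
  have ta : CodeFP (pairE (pairE (pairE unE unE) strE) (pairE strE (pairE strE unE))) strE (fun t => t.2.1) :=
    (snd _ _).fst'
  have tW : CodeFP (pairE (pairE (pairE unE unE) strE) (pairE strE (pairE strE unE))) strE (fun t => t.2.2.1) :=
    (snd _ _).snd'.fst'
  have ts : CodeFP (pairE (pairE (pairE unE unE) strE) (pairE strE (pairE strE unE))) unE (fun t => t.2.2.2) :=
    (snd _ _).snd'.snd'
  have hstep : CodeFP (pairE (pairE (pairE unE unE) strE) (pairE strE (pairE strE unE))) (pairE strE unE) (fun t =>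
      (ObfuscatedGluedTrees.bxor t.2.2.1 (List.zipWith (fun m b => m && b)
        (prpRound t.1.1.2 (t.1.2.getD 1 false) t.2.2.2).2 (fit t.1.1.2 (fit t.1.1.1 t.2.1))), t.2.2.2 + 1)) :=
    (pf_bxor tW (pf_zip (fun m b => m && b) (pf_mask td ti ts) (pf_fit td (pf_fit tμ ta)))).pair (unSucc.comp ts)
  have hinit : CodeFP (pairE (pairE unE unE) strE) (pairE strE unE)
      (fun c : (ℕ × ℕ) × List Bool => (fit c.1.2 (c.2.drop 3), (0 : ℕ))) :=
    (pf_fit (fst _ _).snd' (strDrop.comp ((const _ 3).pair (snd _ _)))).pair (const _ (0 : ℕ))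
  have h := CodeFP.foldl (eσ := pairE (pairE unE unE) strE) (eα := strE) (eβ := pairE strE unE)
    (step := fun (c : (ℕ × ℕ) × List Bool) (a : List Bool) (st : List Bool × ℕ) =>
      (ObfuscatedGluedTrees.bxor st.1 (List.zipWith (fun m b => m && b) (prpRound c.1.2 (c.2.getD 1 false) st.2).2
        (fit c.1.2 (fit c.1.1 a))), st.2 + 1))
    (init := fun c => (fit c.1.2 (c.2.drop 3), (0 : ℕ))) hstep hinit Polynomial.X (fun c l₁ l₂ => by
      rw [pf_foldl_eq, Polynomial.eval_X]
      have h1 : (strE (prpFold c.1.1 c.1.2 (c.2.getD 1 false) (fit c.1.2 (c.2.drop 3)) 0 l₁)).length ≤ c.1.2 :=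
        (pf_length_prpFold_le _ _ _ l₁ _ _).trans (length_fit _ _).le
      have h2 := length_le_length_rawE strE (l₁ ++ l₂)
      rw [List.length_append] at h2
      simp only [pairE_apply, length_boolPair, length_unE]
      omega)
  exact h.fst'.congr fun q => by rw [pf_foldl_eq]

section Assembly

variable {α : Type} {eα : α → List Bool}

/-- **The assembly**: from the codes of `μ`, `d`, `body`, the raw answer list `as` and the Feistel state (all computed
from a common input), the two maps `primQ`, `primOut` — the `match` on the body as the cascade of `CodeFP.ite` of
`pf_primQ_eq` / `pf_primOut_eq` over the three request kinds. [cite: AroraBarak2009, §1.3] -/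
private theorem pf_assemble {fμ fd : α → ℕ} {fb : α → List Bool} {fas : α → List (List Bool)}
    (hμ : CodeFP eα unE fμ) (hd : CodeFP eα unE fd) (hb : CodeFP eα strE fb) (has : CodeFP eα (rawE strE) fas)
    (hW : CodeFP eα strE (fun a =>
      prpFold (fμ a) (fd a) ((fb a).getD 1 false) (fit (fd a) ((fb a).drop 3)) 0 (fas a))) :
    CodeFP eα strE (fun a => primQ (fμ a) (fd a) (fb a) (fas a)) ∧
      CodeFP eα strE (fun a => primOut (fμ a) (fd a) (fb a) (fas a)) := by
  have hs : CodeFP eα unE (fun a => (fas a).length) := (ulength strE).comp has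
  have h0 : CodeFP eα strE (fun a => (fas a).getD 0 []) := (rawGetD strE rfl).comp (has.pair (const _ (0 : ℕ)))
  have h1 : CodeFP eα strE (fun a => (fas a).getD 1 []) := (rawGetD strE rfl).comp (has.pair (const _ (1 : ℕ)))
  have hb0 : CodeFP eα bitE (fun a => (fb a).getD 0 false) := strGetD.comp ((const _ 0).pair hb)
  have hb1 : CodeFP eα bitE (fun a => (fb a).getD 1 false) := strGetD.comp ((const _ 1).pair hb)
  have hb2 : CodeFP eα bitE (fun a => (fb a).getD 2 false) := strGetD.comp ((const _ 2).pair hb)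
  have hg2 : CodeFP eα bitE (fun a => decide (2 ≤ (fb a).length)) := natLeUn.comp ((const _ 2).pair (strLength.comp hb))
  have hg3 : CodeFP eα bitE (fun a => decide (3 ≤ (fb a).length)) := natLeUn.comp ((const _ 3).pair (strLength.comp hb))
  have hℓ : CodeFP eα strE (fun a => (fb a).drop 2) := strDrop.comp ((const _ 2).pair hb)
  have hD : CodeFP eα strE (fun a => dummyLookup (fμ a)) := pf_dummy hμ
  have hN : CodeFP eα strE (fun _ => ([] : List Bool)) := const _ _
  exact ⟨(hg2.ite (hb0.ite (hg3.ite (pf_prpQ hμ hd hb1 hb2 hs hW) hD)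
      (hb1.ite (pf_recQ hμ hℓ hs h0) (pf_encQ hμ hℓ hs h0))) hD).congr fun a => (pf_primQ_eq _ _ _ _).symm,
    (hg2.ite (hb0.ite (hg3.ite hW hN) (hb1.ite (pf_recOut hμ hd hℓ h0 h1) (pf_encOut hμ hℓ h0 h1))) hN).congr
      fun a => (pf_primOut_eq _ _ _ _).symm⟩

end Assembly

/-! ## The registered stub -/

/-- **Stub (layer B, polynomial time)**: the query map `primQ` and the output map `primOut` of the layer-B program are
computed on the codes `⟨⟨⟨1^μ, 1^d⟩, body⟩, as⟩` by polynomial-time string functions (`CodeFP`): every ingredient —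
fitting, masking, the masks and the round schedule, the fold of the Feistel state over the answers (linear growth),
the label test with a capped exponent, indexing the answer list — is a typed combinator of the tree's `CodeFP`
algebra, and the `match` on the body is a cascade of `CodeFP.ite` on its first bits and length (`pf_primQ_eq`,
`pf_primOut_eq`). [cite: AroraBarak2009, §1.3 (closure of polynomial time under composition and bounded loops)] -/
theorem stub_primFP :
    CodeFP (pairE (pairE (pairE unE unE) strE) (listE strE)) strE
        (fun p : ((ℕ × ℕ) × List Bool) × List (List Bool) => primQ p.1.1.1 p.1.1.2 p.1.2 p.2) ∧
      CodeFP (pairE (pairE (pairE unE unE) strE) (listE strE)) strE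
        (fun p : ((ℕ × ℕ) × List Bool) × List (List Bool) => primOut p.1.1.1 p.1.1.2 p.1.2 p.2) := by
  have pμ : CodeFP (pairE (pairE (pairE unE unE) strE) (listE strE)) unE (fun p => p.1.1.1) := (fst _ _).fst'.fst'
  have pd : CodeFP (pairE (pairE (pairE unE unE) strE) (listE strE)) unE (fun p => p.1.1.2) := (fst _ _).fst'.snd'
  have pb : CodeFP (pairE (pairE (pairE unE unE) strE) (listE strE)) strE (fun p => p.1.2) := (fst _ _).snd'
  have pas : CodeFP (pairE (pairE (pairE unE unE) strE) (listE strE)) (rawE strE) (fun p => p.2) :=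
    (rawOfList strE).comp (snd _ _)
  exact pf_assemble pμ pd pb pas (pf_foldFP.comp ((fst _ _).pair pas))

end Summit.QuantumAdvantage.QuantumAdvantage.Theorems.WbwObfuscatedGluedTrees.KnowledgeOfWalk.PrfHybrid

end
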